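import Summits.BirchSwinnertonDyer.Rank1Residual.GaloisImage.NonsplitCartanDictionary
import Summits.BirchSwinnertonDyer.Rank1Residual.GaloisImage.MultiplicativeCartanNormalizer
import HarnessLib

/-!
# BSD rank-≤1 residual cell: the non-split Cartan dictionary, CONVERSE direction
# (`SerreUniformity.HasNonsplitCartanModPImage ⟹` in every frame `G ≤ N(kˣ)`), the EQUIVALENCE,
# and what Furio–Lombardo's dichotomy gives at good ORDINARY and MULTIPLICATIVE primes `p > 37`

HONEST FRAMING (cell `b2b-bsdres-*`, run/shared/lean/b2b/bsd-rank1-residual/, verbatim): the goal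
of the cell is to DELETE the COMBINATION-SHAPED residual classes for ALL analytic-rank `≤ 1` elliptic
curves over `ℚ` — "full BSD formula for every rank `≤ 1` curve in class C" assembled STRICTLY from
published theorems — so that the rank-`≤ 1` remainder becomes exactly the CONSTRUCTION-SHAPED
classes, which are TYPED (missing-input Props), NOT attempted; this is not "finishing BSD".
No claim beyond stated classes; census output = EVIDENCE, never a Literature fact.  Unit
`b2b-bsdres-n1011-p04-g2` (team n1011, O8 image strand, row T-O8c, optional T13).  THEOREMS ONLY
(no definition, no named fact); the published input (Furio–Lombardo 2025 Thm. 1.5, the tree's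
`FurioLombardo2025_imageDichotomy`) enters ONLY as an explicit binder `hFL`.

## What this file does

`NonsplitCartanDictionary.lean` (p251995) proved: frame form `Φ(ρ̄(Γ_ℚ)) ≤ N(kˣ)` ⟹ the explicit
predicate `HasNonsplitCartanModPImage W p`.  Here:

* `exists_gl_mulVec_eq` — an additive automorphism of `𝔽_p²` is `v ↦ Q v`, `Q ∈ GL₂(𝔽_p)`
  (re-proved; the copy in `SerreUniformity/SplitCartanProofs.lean` is private).
* `mul_companion_eq_of_mem_nonsplitCartanNormalizer` — an element of `C_ns⁺(ε)` commutes or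
  anti-commutes with the companion matrix `Y = (0 ε; 1 0)`.
* `exists_le_normalizer_unitGroup_of_hasNonsplitCartanModPImage` — **CONVERSE dictionary**: if in
  some basis every `σ` acts through `C_ns⁺(ε)` (`ε` a non-square), then for EVERY frame `(e₀, Φ)`
  there is a subalgebra `k = 𝔽_p[Y'] ⊆ M₂(𝔽_p)`, a field of degree `2` (`Y' = Q⁻¹ Y Q` the companion
  matrix moved to the frame, `X² - ε` irreducible: `isField_adjoinElem`, `finrank_adjoinElem`),
  with `Φ(ρ̄(Γ_ℚ)) ≤ N(kˣ)` (Serre §2.2: `g Y' g⁻¹ = ±Y'`, `mem_unitGroup_of_conj_eq` /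
  `mem_normalizer_unitGroup_of_conj_eq`).  With p251995: `hasNonsplitCartanModPImage_iff` — **the
  two tree renderings of "non-split Cartan normaliser image" are EQUIVALENT** (`p ≠ 2`).
* Consumers of **Furio–Lombardo 2025 Thm. 1.5** (binder `hFL : FurioLombardo2025_imageDichotomy`:
  non-CM, `p > 37` ⟹ image `= GL₂` or `= C_ns⁺`): `surj_of_goodOrd_of_not_hasCM_of_imageDichotomy`
  — **a non-CM curve is surjective at every good ORDINARY prime `p > 37`** (x9's kernel theorem
  `not_le_normalizer_unitGroup_of_goodOrd`: the inertia split half-Cartan forbids `N(C_ns)`);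
  `surj_of_mult_of_irr_of_imageDichotomy` — and at every MULTIPLICATIVE `p > 37` with `E[p]`
  irreducible (x11c's `not_le_normalizer_unitGroup_of_mult_of_irr_of_not_surj`).  So, GIVEN FL, a
  non-surjective prime `p > 37` of a non-CM curve is a prime of good SUPERSINGULAR or ADDITIVE
  reduction (or multiplicative with `E[p]` reducible, excluded by Mazur for `p > 37` — not used).

What is NOT claimed: FL itself (a binder); anything at `p ≤ 37`; any class theorem.  (X9 / X4(M) /
X4(G-ord, e = 2) are already supported at `p ∈ {5, 7}` by the split-Cartan classification `hB`; the
present consumers are the uniformity-side statement for ALL good-ordinary / multiplicative `p > 37`.)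

## References

* [Serre1972] J.-P. Serre, Invent. Math. 15 (1972), §2.1 b) (`𝔽_p[y]` a field iff the
  characteristic polynomial is irreducible), §2.2 (`N(kˣ)`: `s y s⁻¹ = y` or `ȳ`).
* [FurioLombardo2023] L. Furio, D. Lombardo, arXiv:2305.17780v2, (1.1), Thm. 1.5.
-/

noncomputable section

open scoped Classical
open Matrix Field WeierstrassCurve Literature.NumberTheory.EllipticCurves
  Literature.NumberTheory.GaloisRepresentations Literature.NumberTheory.GaloisRepresentations.Serre1972
  Literature.NumberTheory.EllipticCurves.Rank1Residual Literature.NumberTheory.SerreUniformity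

namespace Summit.BirchSwinnertonDyer.Rank1Residual.GaloisImage

variable {p : ℕ} [hp : Fact p.Prime]

/-! ### Plumbing -/

/-- An additive automorphism `f` of `𝔽_p²` is `v ↦ Q v` for an invertible matrix `Q` (additive maps
of `𝔽_p`-vector spaces are linear).  (The same lemma is private in
`SerreUniformity/SplitCartanProofs.lean`.) [folklore] -/
theorem exists_gl_mulVec_eq (f : (Fin 2 → ZMod p) ≃+ (Fin 2 → ZMod p)) :
    ∃ Q : GL (Fin 2) (ZMod p), ∀ v : Fin 2 → ZMod p,
      ((Q : GL (Fin 2) (ZMod p)) : Matrix (Fin 2) (Fin 2) (ZMod p)) *ᵥ v = f v := by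
  let fL : (Fin 2 → ZMod p) →ₗ[ZMod p] (Fin 2 → ZMod p) := f.toAddMonoidHom.toZModLinearMap p
  let gL : (Fin 2 → ZMod p) →ₗ[ZMod p] (Fin 2 → ZMod p) := f.symm.toAddMonoidHom.toZModLinearMap p
  have hfL : ∀ v, fL v = f v := fun v ↦ rfl
  have hgL : ∀ v, gL v = f.symm v := fun v ↦ rfl
  have hfg : fL.comp gL = LinearMap.id := LinearMap.ext fun v ↦ by simp [hfL, hgL]
  have hgf : gL.comp fL = LinearMap.id := LinearMap.ext fun v ↦ by simp [hfL, hgL]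
  refine ⟨⟨LinearMap.toMatrix' fL, LinearMap.toMatrix' gL, ?_, ?_⟩, fun v ↦ ?_⟩
  · rw [← LinearMap.toMatrix'_comp, hfg, LinearMap.toMatrix'_id]
  · rw [← LinearMap.toMatrix'_comp, hgf, LinearMap.toMatrix'_id]
  · show LinearMap.toMatrix' fL *ᵥ v = f v
    rw [← Matrix.toLin'_apply, Matrix.toLin'_toMatrix', hfL]

/-- An element of `C_ns⁺(ε)` commutes (if in `C_ns(ε)`) or anti-commutes (if in the other coset)
with the companion matrix `Y = (0 ε; 1 0)` of `X² - ε`. [cite: FurioLombardo2023, (1.1)] -/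
theorem mul_companion_eq_of_mem_nonsplitCartanNormalizer {ε : ZMod p}
    {M : Matrix (Fin 2) (Fin 2) (ZMod p)} (hM : M ∈ nonsplitCartanNormalizer ε) :
    M * !![(0 : ZMod p), ε; 1, 0] = !![(0 : ZMod p), ε; 1, 0] * M ∨
      M * !![(0 : ZMod p), ε; 1, 0] = -(!![(0 : ZMod p), ε; 1, 0] * M) := by
  obtain ⟨a, b, -, rfl | rfl⟩ := hM
  · left
    rw [Matrix.mul_fin_two, Matrix.mul_fin_two]
    ext i j
    fin_cases i <;> fin_cases j <;> simp <;> ring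
  · right
    rw [Matrix.mul_fin_two, Matrix.mul_fin_two]
    ext i j
    fin_cases i <;> fin_cases j <;> simp <;> ring

/-! ### The converse dictionary -/

/-- **Non-split Cartan dictionary (explicit matrices ⟹ frame form), for EVERY frame.**  If in some
basis `e` of `E[p]` every `σ ∈ Γ_ℚ` acts through a matrix of `C_ns⁺(ε)`, `ε` a non-square
(`HasNonsplitCartanModPImage W p`), then for every frame `(e₀, Φ)` of `E[p]` there is a subalgebra
`k ⊆ M₂(𝔽_p)` which is a field of degree `2` with `Φ(ρ̄_{E,p}(Γ_ℚ)) ≤ N(kˣ)`: with `Q` the matrix of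
`e ∘ e₀⁻¹` and `Y = (0 ε; 1 0)`, take `k = 𝔽_p[Y']`, `Y' = Q⁻¹ Y Q` (`X² - ε` has no root:
`isField_adjoinElem`; `finrank_adjoinElem`); `Φ(ρ̄ σ) = Q⁻¹ M_σ Q` and `M_σ Y = ±Y M_σ` give
`Φ(ρ̄ σ) Y' Φ(ρ̄ σ)⁻¹ = ±Y'`, i.e. `Φ(ρ̄ σ) ∈ kˣ` or `∈ N(kˣ) ∖ kˣ` (Serre §2.2,
`mem_unitGroup_of_conj_eq`, `mem_normalizer_unitGroup_of_conj_eq`).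
[cite: Serre1972, §2.1 b), §2.2] [cite: FurioLombardo2023, (1.1)] -/
theorem exists_le_normalizer_unitGroup_of_hasNonsplitCartanModPImage (W : WeierstrassCurve ℚ)
    (himg : HasNonsplitCartanModPImage W p)
    (Φ : Multiplicative (AddAut (geomTorsion W p)) ≃* GL (Fin 2) (ZMod p))
    (e₀ : geomTorsion W p ≃+ (Fin 2 → ZMod p))
    (he₀ : ∀ (g : Multiplicative (AddAut (geomTorsion W p))) (x : geomTorsion W p),
      e₀ (Multiplicative.toAdd g x) =
        ((Φ g : GL (Fin 2) (ZMod p)) : Matrix (Fin 2) (Fin 2) (ZMod p)) *ᵥ e₀ x) :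
    ∃ k : Subalgebra (ZMod p) (Matrix (Fin 2) (Fin 2) (ZMod p)), IsField k ∧
      Module.finrank (ZMod p) k = 2 ∧
      (galoisRepTorsion W p).range.map Φ.toMonoidHom ≤
        Subgroup.normalizer (unitGroup k : Set (GL (Fin 2) (ZMod p))) := by
  obtain ⟨e, ε, hε, hσ⟩ := himg
  obtain ⟨Q, hQ⟩ := exists_gl_mulVec_eq (e₀.symm.trans e)
  set Qm : Matrix (Fin 2) (Fin 2) (ZMod p) := ((Q : GL (Fin 2) (ZMod p)) : Matrix (Fin 2) (Fin 2) (ZMod p))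
    with hQm
  set Qi : Matrix (Fin 2) (Fin 2) (ZMod p) :=
    ((Q⁻¹ : GL (Fin 2) (ZMod p)) : Matrix (Fin 2) (Fin 2) (ZMod p)) with hQi
  have hQe : ∀ x : geomTorsion W p, Qm *ᵥ e₀ x = e x := fun x ↦ by
    rw [hQm, hQ, AddEquiv.trans_apply, AddEquiv.symm_apply_apply]
  have hQmQi : Qm * Qi = 1 := by rw [hQm, hQi, ← Units.val_mul, mul_inv_cancel, Units.val_one]
  have hQiQm : Qi * Qm = 1 := by rw [hQm, hQi, ← Units.val_mul, inv_mul_cancel, Units.val_one]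
  -- the companion matrix `Y` of `X² - ε`, moved to the frame: `Y' = Q⁻¹ Y Q`
  set Y : Matrix (Fin 2) (Fin 2) (ZMod p) := !![0, ε; 1, 0] with hY
  have hYtr : Y.trace = 0 := by rw [hY, Matrix.trace_fin_two_of]; ring
  have hYdet : Y.det = -ε := by rw [hY, Matrix.det_fin_two_of]; ring
  set Y' : Matrix (Fin 2) (Fin 2) (ZMod p) := Qi * Y * Qm with hY'
  have hY'tr : Y'.trace = 0 := by
    rw [hY', Matrix.trace_mul_cycle, hQmQi, Matrix.one_mul, hYtr]
  have hY'det : Y'.det = -ε := by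
    have h1 : Qi.det * Qm.det = 1 := by rw [← Matrix.det_mul, hQiQm, Matrix.det_one]
    rw [hY', Matrix.det_mul, Matrix.det_mul, hYdet]
    linear_combination (-ε) * h1
  have hY'no : ∀ l : ZMod p, l ^ 2 - Y'.trace * l + Y'.det ≠ 0 := by
    intro l hl
    rw [hY'tr, hY'det] at hl
    exact hε ⟨l, by linear_combination -hl⟩
  have hY's : ∀ l : ZMod p, Y' ≠ l • 1 := by
    intro l hl
    have hYl : Y = l • 1 := by
      calc Y = Qm * (Qi * Y * Qm) * Qi := by
            calc Y = (Qm * Qi) * Y * (Qm * Qi) := by rw [hQmQi, Matrix.one_mul, Matrix.mul_one]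
              _ = Qm * (Qi * Y * Qm) * Qi := by simp only [Matrix.mul_assoc]
        _ = l • 1 := by rw [← hY', hl, Matrix.mul_smul, Matrix.mul_one, Matrix.smul_mul, hQmQi]
    have h10 := congrFun (congrFun hYl 1) 0
    simp [hY] at h10
  refine ⟨adjoinElem Y', isField_adjoinElem hY'no, finrank_adjoinElem hY's, fun g hg ↦ ?_⟩
  obtain ⟨σ, rfl⟩ := (mem_map_range_galoisRepTorsion_iff W p Φ).mp hg
  obtain ⟨M, hM, hact⟩ := hσ σ
  set gM : GL (Fin 2) (ZMod p) := Φ (galoisRepTorsion W p σ) with hgM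
  -- the matrix of `σ`: `M Q = Q Φ(ρ̄ σ)`, i.e. `Φ(ρ̄ σ) = Q⁻¹ M Q`
  have hMQ : M * Qm = Qm * (gM : Matrix (Fin 2) (Fin 2) (ZMod p)) := by
    apply Matrix.mulVec_injective
    funext v
    obtain ⟨x, rfl⟩ := e₀.surjective v
    rw [← Matrix.mulVec_mulVec, ← Matrix.mulVec_mulVec, hQe, ← hact,
      ← he₀ (galoisRepTorsion W p σ) x, galoisRepTorsion_apply, hQe]
  have hg : (gM : Matrix (Fin 2) (Fin 2) (ZMod p)) = Qi * M * Qm := by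
    calc (gM : Matrix (Fin 2) (Fin 2) (ZMod p)) = Qi * Qm * gM := by rw [hQiQm, Matrix.one_mul]
      _ = Qi * (M * Qm) := by rw [Matrix.mul_assoc, ← hMQ]
      _ = Qi * M * Qm := by rw [Matrix.mul_assoc]
  have hginv : (gM : Matrix (Fin 2) (Fin 2) (ZMod p)) * (gM : Matrix (Fin 2) (Fin 2) (ZMod p))⁻¹ = 1 :=
    Matrix.mul_nonsing_inv _ (GL2.det_ne_zero gM).isUnit
  have hgY' : (gM : Matrix (Fin 2) (Fin 2) (ZMod p)) * Y' = Qi * (M * Y) * Qm := by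
    rw [hg, hY']
    calc Qi * M * Qm * (Qi * Y * Qm) = Qi * M * (Qm * Qi) * Y * Qm := by simp only [Matrix.mul_assoc]
      _ = Qi * (M * Y) * Qm := by rw [hQmQi, Matrix.mul_one]; simp only [Matrix.mul_assoc]
  have hY'g : Y' * (gM : Matrix (Fin 2) (Fin 2) (ZMod p)) = Qi * (Y * M) * Qm := by
    rw [hg, hY']
    calc Qi * Y * Qm * (Qi * M * Qm) = Qi * Y * (Qm * Qi) * M * Qm := by simp only [Matrix.mul_assoc]
      _ = Qi * (Y * M) * Qm := by rw [hQmQi, Matrix.mul_one]; simp only [Matrix.mul_assoc]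
  rcases mul_companion_eq_of_mem_nonsplitCartanNormalizer hM with hMY | hMY
  · -- `M ∈ C_ns(ε)`: `Φ(ρ̄ σ)` commutes with `Y'`, hence lies in `kˣ`
    have hconj : (gM : Matrix (Fin 2) (Fin 2) (ZMod p)) * Y' *
        (gM : Matrix (Fin 2) (Fin 2) (ZMod p))⁻¹ = Y' := by
      rw [hgY', hMY, ← hY'g, Matrix.mul_assoc, hginv, Matrix.mul_one]
    exact Subgroup.le_normalizer (mem_unitGroup_of_conj_eq (self_mem_adjoinElem Y') hY's hconj)
  · -- `M ∈ C_ns⁺(ε) ∖ C_ns(ε)`: `Φ(ρ̄ σ)` anti-commutes with `Y'`, i.e. sends it to `ȳ' = -Y'`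
    have hconj : (gM : Matrix (Fin 2) (Fin 2) (ZMod p)) * Y' *
        (gM : Matrix (Fin 2) (Fin 2) (ZMod p))⁻¹ = Y'.trace • (1 : Matrix (Fin 2) (Fin 2) (ZMod p)) - Y' := by
      rw [hY'tr, zero_smul, zero_sub, hgY', hMY, Matrix.mul_neg, Matrix.neg_mul, ← hY'g,
        Matrix.neg_mul, Matrix.mul_assoc, hginv, Matrix.mul_one]
    exact mem_normalizer_unitGroup_of_conj_eq (finrank_adjoinElem hY's) (self_mem_adjoinElem Y')
      hY's hconj

/-- **The two tree renderings of "the mod-`p` image normalises a non-split Cartan subgroup" are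
EQUIVALENT** (`p ≠ 2`): the explicit predicate `HasNonsplitCartanModPImage W p` of the
Serre-uniformity dossier holds iff in some (equivalently every) frame `(e, Φ)` of `E[p]` the image
`Φ(ρ̄_{E,p}(Γ_ℚ))` lies in `N(kˣ)` for a subalgebra `k ⊆ M₂(𝔽_p)` which is a field of degree `2`
(`hasNonsplitCartanModPImage_of_le_normalizer_unitGroup`, p251995, and the converse above).
[cite: Serre1972, §2.1–2.2] [cite: FurioLombardo2023, (1.1)] -/
theorem hasNonsplitCartanModPImage_iff (hp2 : p ≠ 2) (W : WeierstrassCurve ℚ)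
    (Φ : Multiplicative (AddAut (geomTorsion W p)) ≃* GL (Fin 2) (ZMod p))
    (e : geomTorsion W p ≃+ (Fin 2 → ZMod p))
    (he : ∀ (g : Multiplicative (AddAut (geomTorsion W p))) (x : geomTorsion W p),
      e (Multiplicative.toAdd g x) =
        ((Φ g : GL (Fin 2) (ZMod p)) : Matrix (Fin 2) (Fin 2) (ZMod p)) *ᵥ e x) :
    HasNonsplitCartanModPImage W p ↔
      ∃ k : Subalgebra (ZMod p) (Matrix (Fin 2) (Fin 2) (ZMod p)), IsField k ∧
        Module.finrank (ZMod p) k = 2 ∧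
        (galoisRepTorsion W p).range.map Φ.toMonoidHom ≤
          Subgroup.normalizer (unitGroup k : Set (GL (Fin 2) (ZMod p))) :=
  ⟨fun h ↦ exists_le_normalizer_unitGroup_of_hasNonsplitCartanModPImage W h Φ e he,
    fun ⟨_, hk, h2, hle⟩ ↦ hasNonsplitCartanModPImage_of_le_normalizer_unitGroup hp2 W Φ e he hk h2 hle⟩

/-! ### Consumers of Furio–Lombardo 2025: good ordinary and multiplicative primes `p > 37` -/

section FurioLombardo

variable (W : WeierstrassCurve ℚ) [W.IsElliptic] (p)

/-- **Given Furio–Lombardo 2025 Thm. 1.5 (binder `hFL`), a non-CM curve has SURJECTIVE `ρ̄_{E,p}`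
at every prime `p > 37` of good ORDINARY reduction.**  FL leaves `GL₂` or EXACTLY `C_ns⁺(p)`; the
latter is a non-split Cartan normaliser image (`HasNonsplitCartanModPImage`), which by the converse
dictionary puts `Φ(ρ̄(Γ_ℚ))` inside some `N(kˣ)` — impossible at a good ordinary `p ≥ 5`, where
the image contains a split half-Cartan subgroup (x9's `not_le_normalizer_unitGroup_of_goodOrd`,
Serre §1.11 + Prop. 14).  Nothing is claimed for `p ≤ 37`.
[cite: FurioLombardo2023, Thm. 1.5] [cite: Serre1972, §1.11 Cor. to Prop. 11, §2.2 Prop. 14] -/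
theorem surj_of_goodOrd_of_not_hasCM_of_imageDichotomy [W.IsGloballyMinimal]
    (hFL : FurioLombardo2025_imageDichotomy) (hCM : ¬ W.HasCM) (h37 : 37 < p)
    (hord : GoodOrd W p) : Surj W p := by
  rcases hFL W hCM p hp.out h37 with hs | hns
  · exact hs
  · obtain ⟨e, Φ, he, -⟩ := exists_frame_galoisRepTorsion_rat W p
    obtain ⟨k, hk, h2, hle⟩ := exists_le_normalizer_unitGroup_of_hasNonsplitCartanModPImage W
      hns.hasNonsplitCartanModPImage Φ e he
    exact absurd hle (not_le_normalizer_unitGroup_of_goodOrd W p Φ e he (by omega) hord hk h2)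

/-- **Given Furio–Lombardo 2025 Thm. 1.5, a non-CM curve with `E[p]` irreducible has SURJECTIVE
`ρ̄_{E,p}` at every MULTIPLICATIVE prime `p > 37`** (x11c's
`not_le_normalizer_unitGroup_of_mult_of_irr_of_not_surj`: at a multiplicative `p ≥ 7` with
`Irr ∧ ¬Surj` the image is in no non-split Cartan normaliser).  (`¬CM` is automatic at a
multiplicative prime — `not_hasCM_of_hasMultiplicativeReductionAtPrime'` — but kept as a binder to
keep this file's imports light; `Irr` holds for `p > 37` by Mazur's theorem, not used here.)
[cite: FurioLombardo2023, Thm. 1.5] [cite: Serre1972, §1.12, §2.2 Prop. 14] -/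
theorem surj_of_mult_of_irr_of_imageDichotomy (hFL : FurioLombardo2025_imageDichotomy)
    (hCM : ¬ W.HasCM) (h37 : 37 < p) (hmult : Mult W p) (hirr : Irr W p) : Surj W p := by
  rcases hFL W hCM p hp.out h37 with hs | hns
  · exact hs
  · by_contra hns'
    obtain ⟨e, Φ, he, -⟩ := exists_frame_galoisRepTorsion_rat W p
    obtain ⟨k, hk, h2, hle⟩ := exists_le_normalizer_unitGroup_of_hasNonsplitCartanModPImage W
      hns.hasNonsplitCartanModPImage Φ e he
    exact not_le_normalizer_unitGroup_of_mult_of_irr_of_not_surj W p Φ e he (by omega) hmult hirr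
      hns' hk h2 hle

end FurioLombardo

end Summit.BirchSwinnertonDyer.Rank1Residual.GaloisImage

end
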